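import Summits.ValiantsHypothesis.ValiantsHypothesis.Theorems.BarrierLeverAnchoredDoorHitsLowerPairsStarCumulativeMass
import Summits.ValiantsHypothesis.ValiantsHypothesis.Theorems.BarrierLeverAnchoredDoorHitsLowerPairsStarExcessNode
import Summits.ValiantsHypothesis.ValiantsHypothesis.Theorems.BarrierLeverAnchoredDoorHitsLowerPairsStarSmallColumns

/-!
# Route BarrierLever — support item `AnchoredDoorHitsLowerPairs` (stmt-ValiantsHypothesis-22510), line `anchored_peeling`:
# **STAR-LOWER IS FALSE** — the star-forest door misses (2-dimensional rows, complete-graph columns)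

Refutation file (`--supports stmt-ValiantsHypothesis-22510`; val-np-p1 g36). `not_conjStarLower : ¬ Stmt.conjStarLower` kills the door slot of record
`stub_conjStarLower` and, by the landed arrows, every node implying it (`not_conjStarTN`, `not_conjStarOrdered`, `not_conjStarMassMerge`,
`not_conjStarCumulativeMass`, `not_conjStarLowerExcessTwo`, `not_conjStarLowerFaceRich`). It does NOT refute the item `AnchoredDoorHitsLowerPairs` (the
counterexample has a thin side — all column faces have size ≤ 2 — which the full profile-2 door hits, `symbolicDet_ne_zero_of_card_le`), nothing here
bears on crux 14610, and `VP ≠ VNP` is NOT proved.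

THE COUNTEREXAMPLE (memo HOME/val-np-p1/g36/REFUTATION-conjStarLower.md): rows `u` = all subsets of size ≤ 3 of the first `m = 45` vertices, columns
`w` = all subsets of size ≤ 2 of `n = 174` vertices (`r = 15226` each; the smallest instance of the mechanism is `m = 10`, `n = 17`, `r = 154`, and
`(B(11,3), K₂₁^{(≤2)})`, `r = 232`, is the smallest «complete versus complete» one — checked numerically: exact integer determinant `0`, rank `209/232`).
PROOF. Write `h_{be} = g_{be} + d_{be}`. For a row `A` with `|A| ≤ 3` and column vertices `e ≠ e'` (`starDelta_card_le_three`):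
  `M[A,{e,e'}] − M[A,{e}] − M[A,{e'}] + M[A,∅] = Σ_{b∈A} d_{be}d_{be'} + Σ_{b≠b'∈A} h_{be}h_{b'e'} + [|A|=3]·Σ_{c∈A}(h_{ce'}∏_{b∈A∖c}g_{be} + h_{ce}∏_{b∈A∖c}g_{be'})`
(closed forms `starEntry_col_empty/_singleton/_pair`, valid for every `A`). Hence for vectors `U, V` on the column vertices with DISJOINT supports,
`U ⊥ h_c`, `U ⊥ d_c`, `V ⊥ h_c` for every row vertex `c`, the column vector `y_S = Σ_{e,e'} U_e V_{e'}([S=∅] − [S={e}] − [S={e'}] + [S={e,e'}])` is in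
the kernel of the star block; such `U ≠ 0` (resp. `V ≠ 0`) supported on `2m+1 = 91` (resp. `m+1 = 46` further) column vertices exist because
`90 < 91` and `45 < 46` homogeneous linear conditions have a nonzero solution (`LinearMap.ker_ne_bot_of_finrank_lt`), and `y_{{e₀,e₀'}} = U_{e₀}V_{e₀'} ≠ 0`;
so `det = 0` for ALL weights (`Matrix.exists_mulVec_eq_zero_iff`).
-/

set_option linter.dupNamespace false

namespace Summit.ValiantsHypothesis.ValiantsHypothesis.Theorems.BarrierLever.AnchoredPeeling

open Finset

noncomputable section

namespace StarDoor

/-! ## 4. The counterexample: rows = all faces of size ≤ 3 on 45 vertices, columns = all faces of size ≤ 2 on 174 vertices -/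

namespace Cex

/-- Number of vertices: `174 = 91 + (46 + 37)` (the three blocks carry `U`, `V`, nothing). -/
abbrev N : ℕ := 91 + (46 + 37)

/-- `45 ≤ N`. -/
theorem le_N : 45 ≤ N := by decide

/-- The 45 row vertices. -/
def rowV (c : Fin 45) : Fin N := Fin.castLE le_N c
/-- The 91 column vertices carrying `U`. -/
def colU (k : Fin 91) : Fin N := Fin.castAdd (46 + 37) k
/-- The 46 column vertices carrying `V`. -/
def colV (k : Fin 46) : Fin N := Fin.natAdd 91 (Fin.castAdd 37 k)

/-- The row vertex set. -/
def X0 : Finset (Fin N) := Finset.univ.map (Fin.castLEEmb le_N)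

/-- `|X0| = 45`. -/
theorem card_X0 : X0.card = 45 := by simp [X0]

/-- Membership in the row vertex set. -/
theorem mem_X0 {b : Fin N} : b ∈ X0 ↔ ∃ c : Fin 45, rowV c = b := by
  simp [X0, rowV, Fin.castLEEmb]

/-- The row family: all faces of size ≤ 3 inside `X0`. -/
def FI : Finset (Finset (Fin N)) := (Finset.range 4).biUnion fun k => X0.powersetCard k
/-- The column family: all faces of size ≤ 2. -/
def FJ : Finset (Finset (Fin N)) := (Finset.range 3).biUnion fun k => (Finset.univ : Finset (Fin N)).powersetCard k

/-- Membership in the row family: faces of size ≤ 3 inside `X0`. -/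
theorem mem_FI {S : Finset (Fin N)} : S ∈ FI ↔ S ⊆ X0 ∧ S.card ≤ 3 := by
  simp only [FI, Finset.mem_biUnion, Finset.mem_range, Finset.mem_powersetCard]
  constructor
  · rintro ⟨k, hk, hsub, hcard⟩; exact ⟨hsub, by omega⟩
  · rintro ⟨hsub, hcard⟩; exact ⟨S.card, by omega, hsub, rfl⟩

/-- Membership in the column family: faces of size ≤ 2. -/
theorem mem_FJ {S : Finset (Fin N)} : S ∈ FJ ↔ S.card ≤ 2 := by
  simp only [FJ, Finset.mem_biUnion, Finset.mem_range, Finset.mem_powersetCard]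
  constructor
  · rintro ⟨k, hk, _, hcard⟩; omega
  · intro hcard; exact ⟨S.card, by omega, Finset.subset_univ S, rfl⟩

set_option maxRecDepth 20000 in
/-- `|FI| = 1 + 45 + 990 + 14190 = 15226`. -/
theorem card_FI : FI.card = 15226 := by
  rw [FI, Finset.card_biUnion]
  · simp only [Finset.card_powersetCard, card_X0, Finset.sum_range_succ, Finset.sum_range_zero]
    decide
  · intro k _ k' _ hkk'
    exact Finset.disjoint_left.mpr fun S hS hS' => hkk' (by
      rw [Finset.mem_powersetCard] at hS hS'; rw [← hS.2, ← hS'.2])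

set_option maxRecDepth 20000 in
/-- `|FJ| = 1 + 174 + 15051 = 15226`. -/
theorem card_FJ : FJ.card = 15226 := by
  rw [FJ, Finset.card_biUnion]
  · simp only [Finset.card_powersetCard, Finset.card_univ, Fintype.card_fin, Finset.sum_range_succ, Finset.sum_range_zero]
    decide
  · intro k _ k' _ hkk'
    exact Finset.disjoint_left.mpr fun S hS hS' => hkk' (by
      rw [Finset.mem_powersetCard] at hS hS'; rw [← hS.2, ← hS'.2])

/-- Enumerations of the two families. -/
def eI : {S // S ∈ FI} ≃ Fin 15226 := FI.equivFinOfCardEq card_FI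
/-- Enumeration of the column family. -/
def eJ : {S // S ∈ FJ} ≃ Fin 15226 := FJ.equivFinOfCardEq card_FJ

/-- The row enumeration `u`. -/
def uC (i : Fin 15226) : Finset (Fin N) := (eI.symm i).1
/-- The column enumeration `w`. -/
def wC (j : Fin 15226) : Finset (Fin N) := (eJ.symm j).1

/-- Rows are faces of the row family. -/
theorem uC_mem (i : Fin 15226) : uC i ∈ FI := (eI.symm i).2
/-- Columns are faces of the column family. -/
theorem wC_mem (j : Fin 15226) : wC j ∈ FJ := (eJ.symm j).2

/-- `u` is injective. -/
theorem uC_injective : Function.Injective uC := fun _ _ hij => eI.symm.injective (Subtype.ext hij)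
/-- `w` is injective. -/
theorem wC_injective : Function.Injective wC := fun _ _ hij => eJ.symm.injective (Subtype.ext hij)

/-- The range of `u` is the row family. -/
theorem range_uC : Set.range uC = {S | S ∈ FI} := by
  ext S; constructor
  · rintro ⟨i, rfl⟩; exact uC_mem i
  · intro hS; exact ⟨eI ⟨S, hS⟩, by simp [uC]⟩

/-- The range of `w` is the column family. -/
theorem range_wC : Set.range wC = {S | S ∈ FJ} := by
  ext S; constructor
  · rintro ⟨j, rfl⟩; exact wC_mem j
  · intro hS; exact ⟨eJ ⟨S, hS⟩, by simp [wC]⟩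

/-- The row family is a lower set. -/
theorem isLowerSet_range_uC : IsLowerSet (Set.range uC) := by
  rw [range_uC]
  intro S T hTS hS
  rw [Set.mem_setOf_eq, mem_FI] at hS ⊢
  exact ⟨hTS.trans hS.1, (Finset.card_le_card hTS).trans hS.2⟩

/-- The column family is a lower set. -/
theorem isLowerSet_range_wC : IsLowerSet (Set.range wC) := by
  rw [range_wC]
  intro S T hTS hS
  rw [Set.mem_setOf_eq, mem_FJ] at hS ⊢
  exact (Finset.card_le_card hTS).trans hS

/-- Sums over the column index are sums over `FJ`. -/
theorem sum_wC (F : Finset (Fin N) → ℂ) : ∑ j : Fin 15226, F (wC j) = ∑ S ∈ FJ, F S := by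
  rw [← Finset.sum_coe_sort FJ, ← Equiv.sum_comp eJ.symm (fun x : {S // S ∈ FJ} => F x.1)]
  rfl

/-- **THE DETERMINANT VANISHES IDENTICALLY.** -/
theorem starDet_eq_zero (g d : Fin N → Fin N → ℂ) :
    (Matrix.of fun i j : Fin 15226 => starEntry g d (uC i) (wC j)).det = 0 := by
  classical
  -- (1) the vector `u` on the first 91 column vertices: 90 linear conditions
  let CU : Matrix (Fin 45 ⊕ Fin 45) (Fin 91) ℂ :=
    Matrix.of fun j k => Sum.elim (fun c => g (rowV c) (colU k) + d (rowV c) (colU k)) (fun c => d (rowV c) (colU k)) j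
  have hkerU : LinearMap.ker (Matrix.mulVecLin CU) ≠ ⊥ := by
    apply LinearMap.ker_ne_bot_of_finrank_lt
    rw [Module.finrank_fintype_fun_eq_card, Module.finrank_fintype_fun_eq_card]
    simp
  obtain ⟨u, hu_mem, hu_ne⟩ := (Submodule.ne_bot_iff _).mp hkerU
  have hu : CU.mulVec u = 0 := by simpa using hu_mem
  -- (2) the vector `v` on the next 46 column vertices: 45 linear conditions
  let CV : Matrix (Fin 45) (Fin 46) ℂ := Matrix.of fun c k => g (rowV c) (colV k) + d (rowV c) (colV k)
  have hkerV : LinearMap.ker (Matrix.mulVecLin CV) ≠ ⊥ := by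
    apply LinearMap.ker_ne_bot_of_finrank_lt
    rw [Module.finrank_fintype_fun_eq_card, Module.finrank_fintype_fun_eq_card]
    simp
  obtain ⟨v, hv_mem, hv_ne⟩ := (Submodule.ne_bot_iff _).mp hkerV
  have hv : CV.mulVec v = 0 := by simpa using hv_mem
  -- (3) extend by zero
  let U : Fin N → ℂ := Fin.append u (0 : Fin (46 + 37) → ℂ)
  let V : Fin N → ℂ := Fin.append (0 : Fin 91 → ℂ) (Fin.append v (0 : Fin 37 → ℂ))
  have hUl : ∀ k, U (colU k) = u k := fun k => by simp [U, colU]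
  have hUr : ∀ k : Fin (46 + 37), U (Fin.natAdd 91 k) = 0 := fun k => by simp [U]
  have hVl : ∀ k : Fin 91, V (Fin.castAdd (46 + 37) k) = 0 := fun k => by simp [V]
  have hVm : ∀ k, V (colV k) = v k := fun k => by simp [V, colV]
  have hsumU : ∀ F : Fin N → ℂ, ∑ e, U e * F e = ∑ k, u k * F (colU k) := by
    intro F; rw [Fin.sum_univ_add]; simp [U, colU]
  have hsumV : ∀ F : Fin N → ℂ, ∑ e, V e * F e = ∑ k, v k * F (colV k) := by
    intro F; rw [Fin.sum_univ_add]; simp only [hVl, zero_mul, Finset.sum_const_zero, zero_add]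
    rw [Fin.sum_univ_add]; simp [V, colV]
  -- (4) the orthogonality relations on the row vertices
  have HU : ∀ c : Fin 45, ∑ e, U e * (g (rowV c) e + d (rowV c) e) = 0 := by
    intro c
    have := congr_fun hu (Sum.inl c)
    simp only [Matrix.mulVec, dotProduct, Matrix.of_apply, Sum.elim_inl, Pi.zero_apply, CU] at this
    rw [hsumU]; rw [← this]; exact Finset.sum_congr rfl fun k _ => by ring
  have DU : ∀ c : Fin 45, ∑ e, U e * d (rowV c) e = 0 := by
    intro c
    have := congr_fun hu (Sum.inr c)
    simp only [Matrix.mulVec, dotProduct, Matrix.of_apply, Sum.elim_inr, Pi.zero_apply, CU] at this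
    rw [hsumU]; rw [← this]; exact Finset.sum_congr rfl fun k _ => by ring
  have HV : ∀ c : Fin 45, ∑ e, V e * (g (rowV c) e + d (rowV c) e) = 0 := by
    intro c
    have := congr_fun hv c
    simp only [Matrix.mulVec, dotProduct, Matrix.of_apply, Pi.zero_apply, CV] at this
    rw [hsumV]; rw [← this]; exact Finset.sum_congr rfl fun k _ => by ring
  have UV : ∀ e, U e * V e = 0 := by
    intro e
    refine Fin.addCases (fun k => ?_) (fun k => ?_) e
    · rw [hVl k, mul_zero]
    · rw [hUr k, zero_mul]
  -- (5) the kernel vector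
  let y : Fin 15226 → ℂ := fun j => kerVec U V (wC j)
  have hmul : (Matrix.of fun i j : Fin 15226 => starEntry g d (uC i) (wC j)).mulVec y = 0 := by
    funext i
    simp only [Matrix.mulVec, dotProduct, Matrix.of_apply, Pi.zero_apply, y]
    rw [sum_wC (fun S => starEntry g d (uC i) S * kerVec U V S)]
    have hA := (mem_FI.mp (uC_mem i))
    rw [sum_starEntry_mul_kerVec g d (uC i) U V FJ (mem_FJ.mpr (by simp)) (fun e => mem_FJ.mpr (by simp))
      (fun e e' => mem_FJ.mpr (Finset.card_insert_le e {e'} |>.trans (by simp)))]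
    refine sum_starDelta_eq_zero g d hA.2 U V UV ?_ ?_ ?_
    · intro c hc; obtain ⟨c', rfl⟩ := mem_X0.mp (hA.1 hc); exact HU c'
    · intro c hc; obtain ⟨c', rfl⟩ := mem_X0.mp (hA.1 hc); exact DU c'
    · intro c hc; obtain ⟨c', rfl⟩ := mem_X0.mp (hA.1 hc); exact HV c'
  -- (6) the kernel vector is nonzero
  obtain ⟨k₀, hk₀⟩ := Function.ne_iff.mp hu_ne
  obtain ⟨k₁, hk₁⟩ := Function.ne_iff.mp hv_ne
  have hU0 : U (colU k₀) ≠ 0 := by rw [hUl]; exact hk₀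
  have hV1 : V (colV k₁) ≠ 0 := by rw [hVm]; exact hk₁
  have hU1 : U (colV k₁) = 0 := hUr _
  have hV0 : V (colU k₀) = 0 := hVl _
  have hne01 : colU k₀ ≠ colV k₁ := fun h => hU0 (h ▸ hU1)
  have hval : kerVec U V {colU k₀, colV k₁} = U (colU k₀) * V (colV k₁) := by
    unfold kerVec pairCoef
    have hne_empty : ({colU k₀, colV k₁} : Finset (Fin N)) ≠ ∅ := Finset.insert_ne_empty _ _
    have hcard2 : ({colU k₀, colV k₁} : Finset (Fin N)).card = 2 := Finset.card_pair hne01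
    have hne_single : ∀ e : Fin N, ({colU k₀, colV k₁} : Finset (Fin N)) ≠ {e} := by
      intro e h; have := congr_arg Finset.card h; rw [hcard2, Finset.card_singleton] at this; omega
    simp only [hne_empty, hne_single, if_false, sub_zero, zero_add]
    rw [Finset.sum_eq_single (colU k₀)]
    · rw [Finset.sum_eq_single (colV k₁)]
      · simp
      · intro e' _ he'
        by_cases hVe : V e' = 0
        · rw [hVe]; simp
        · have hind : ({colU k₀, colV k₁} : Finset (Fin N)) ≠ {colU k₀, e'} := by
            intro h
            have hm : e' ∈ ({colU k₀, colV k₁} : Finset (Fin N)) := by rw [h]; simp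
            rw [Finset.mem_insert, Finset.mem_singleton] at hm
            rcases hm with h0 | h1
            · exact hVe (h0 ▸ hV0)
            · exact he' h1
          simp [hind]
      · intro h; exact absurd (Finset.mem_univ _) h
    · intro e _ he
      refine Finset.sum_eq_zero fun e' _ => ?_
      by_cases hUe : U e = 0
      · rw [hUe]; simp
      · have hind : ({colU k₀, colV k₁} : Finset (Fin N)) ≠ {e, e'} := by
          intro h
          have hm : e ∈ ({colU k₀, colV k₁} : Finset (Fin N)) := by rw [h]; simp
          rw [Finset.mem_insert, Finset.mem_singleton] at hm
          rcases hm with h0 | h1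
          · exact he h0
          · exact hUe (h1 ▸ hU1)
        simp [hind]
    · intro h; exact absurd (Finset.mem_univ _) h
  have hy_ne : y ≠ 0 := by
    intro hy
    have hmem : ({colU k₀, colV k₁} : Finset (Fin N)) ∈ FJ := mem_FJ.mpr (by rw [Finset.card_pair hne01])
    have h1 := congr_fun hy (eJ ⟨_, hmem⟩)
    simp only [y, wC, Equiv.symm_apply_apply, Pi.zero_apply] at h1
    rw [hval] at h1
    exact mul_ne_zero hU0 hV1 h1
  exact Matrix.exists_mulVec_eq_zero_iff.mp ⟨y, hy_ne, hmul⟩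

end Cex

end StarDoor

/-! ## 5. The refutations by name -/

/-- **STAR-LOWER IS FALSE** (`Stmt.conjStarLower`, …StarDoor; the door slot `stub_conjStarLower` of item 22510). -/
theorem not_conjStarLower : ¬ Stmt.conjStarLower := by
  intro H
  obtain ⟨g, d, hdet⟩ := H StarDoor.Cex.N 15226 StarDoor.Cex.uC StarDoor.Cex.wC StarDoor.Cex.uC_injective StarDoor.Cex.wC_injective
    StarDoor.Cex.isLowerSet_range_uC StarDoor.Cex.isLowerSet_range_wC
  exact hdet (StarDoor.Cex.starDet_eq_zero g d)

/-- TN-STAR is false. -/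
theorem not_conjStarTN : ¬ Stmt.conjStarTN := fun H => not_conjStarLower (conjStarLower_of_conjStarTN H)

/-- ORDERED STAR-LOWER (…StarOrdered, this session) is false. -/
theorem not_conjStarOrdered : ¬ Stmt.conjStarOrdered := fun H => not_conjStarLower (conjStarLower_of_conjStarOrdered H)

/-- The mass-merge node (…StarMassMerge, this session) is false. -/
theorem not_conjStarMassMerge : ¬ Stmt.conjStarMassMerge :=
  fun H => not_conjStarOrdered (conjStarOrdered_of_conjStarMassMerge H)

/-- The cumulative-mass node (…StarCumulativeMass, this session) is false. -/
theorem not_conjStarCumulativeMass : ¬ Stmt.conjStarCumulativeMass :=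
  fun H => not_conjStarOrdered (conjStarOrdered_of_conjStarCumulativeMass H)

/-- The excess-two residual node (…StarExcessNode) is false. -/
theorem not_conjStarLowerExcessTwo : ¬ Stmt.conjStarLowerExcessTwo :=
  fun H => not_conjStarLower (conjStarLower_of_excessTwo H)

/-- The face-rich node (…StarTwoCentre) is false. -/
theorem not_conjStarLowerFaceRich : ¬ Stmt.conjStarLowerFaceRich :=
  fun H => not_conjStarLower (conjStarLower_of_faceRich H)

end

end Summit.ValiantsHypothesis.ValiantsHypothesis.Theorems.BarrierLever.AnchoredPeeling
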